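import Summits.AtomisticToContinuum.BoseEinsteinCondensation.Theorems.BECThomsonPrincipleGaussianDominationCanChordCuts
import Summits.AtomisticToContinuum.BoseEinsteinCondensation.Theorems.BECThomsonPrincipleGaussianDominationCanChordTransportFrom
import Summits.AtomisticToContinuum.BoseEinsteinCondensation.Theorems.BECThomsonPrincipleGaussianDominationCanHardCoreReduction
import Mathlib.Topology.Order.IntermediateValue
import HarnessLib

/-!
# `GaussianDominationCan` ⟸ the sign B on the CORE range only (line `coupling-monotone-chord`, skeleton r8)

Route `BECThomsonPrinciple`, crux `GaussianDominationCan` (stmt-AtomisticToContinuum-9479).  Supports (does not close) the item: it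
proves the registered lead stub `stub_gdCan_of_sourceRaisesInteractionCore` of skeleton r8
(`Cruxes/GaussianDominationCan/Lines/coupling_monotone_chord.lean`, lead c1).

**What is proved.**  The line's engine composes the crux from ONE sign — "the LNSS source never lowers the ground-state
interaction energy" — transported along the coupling ray `τ ↦ τ•w` from the proved free chord.  The full sign B
(`SourceRaisesInteraction`, every `s ≥ 0`) already gives the crux for every admissible `v` (`…HardCoreReduction.lean`).  Here the
sign is required ONLY ON THE CORE RANGE of source strengths, at each bounded ray potential `w'` of range `R₀` in the dilute window:

  `s · L² < 4π² √N ‖n‖∞²`  (below the automatic chord: `2sN|I| ≤ 2s√N`, side stubs S1/S2 `stub_lnssSourceBound`, `stub_chordAutomatic`), and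
  `s² L² ≤ 4π² ‖n‖∞² E₀(w')`  (below the anchor band of the free chord with constant `C = 1/(2π²)`, side stub S3 `stub_anchorBand`).

Composition (`gdChordBody_of_coreSign`, bounded `w`): for `s` above the first threshold the chord is automatic; for `s` above the
anchor band of `w` itself the chord is the anchor band; otherwise `s > 0` and `y := s²L²/(4π²‖n‖²) ∈ (0, E₀(w))`, and since
`τ ↦ E₀(τ•w)` is continuous (Lipschitz, `ray_continuousOn`) and non-decreasing with `E₀(0•w) = 0`, the intermediate value theorem gives
`τ₀ ∈ [0, 1)` with `E₀(τ₀•w) = y` — the anchor band holds AT `τ₀•w` with constant `1/(2π²)` — and for every `τ ∈ (τ₀, 1]` the point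
`(τ•w, s)` is in the core (`E₀(τ•w) ≥ y`), so the per-`s` transport from `τ₀` (side stub S4 `stub_chordTransportFrom`) carries the chord
to `w`.  Hard cores: `truncationLimit_holds`.  Constant `C = 1/(2π²)`, `N₀ = 0`, `ρ₀ = ρ₀_core(M, R₀(v))`.

The core sign is implied by B and is still crux-sized at `s → 0` (it contains the `T = 0` phase-stiffness germ of the crux; see
`Cruxes/GaussianDominationCan/Lines/coupling-monotone-chord-dead.md`, `STRATEGY-CENSUS.md`): this file TRIMS the open hypothesis of the
line (large-`s` tail and above-anchor band removed), it does not lower the wall.  References: W. Thirring, *Quantum Mathematical Physics*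
§3.5 (concavity / Feynman–Hellmann); M. Lewin, P. T. Nam, S. Serfaty, J. P. Solovej, arXiv:1211.2778 (the excitation operator `Λ_k`).
-/

noncomputable section

namespace Summit.AtomisticToContinuum.BoseEinsteinCondensation.Cruxes.GaussianDominationCan.CouplingMonotoneChord

open MeasureTheory Set Filter Topology
open scoped ENNReal NNReal
open Literature.MathematicalPhysics.QuantumManyBody.BoseGas
open Summit.AtomisticToContinuum.BoseEinsteinCondensation.Theses
open Summit.AtomisticToContinuum.BoseEinsteinCondensation.Theorems.GaussianDominationCan.Negative
  (GDIneq InWindow GDCanWith gaussianDominationCan_iff sourceIntegral constState periodicEnergy_constState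
    one_le_norm_intVec)

/-! ## The ground-state energy along the coupling ray of a bounded potential -/

section Ray

variable {m : ℕ} {L : ℝ} {w : ℝ → ℝ≥0∞} {Wm : ℝ}

/-- The ray is pointwise monotone: `τ ≤ τ'` gives `τ•w ≤ τ'•w`. [folklore] -/
theorem scalePot_mono (w : ℝ → ℝ≥0∞) {τ τ' : ℝ} (h : τ ≤ τ') (r : ℝ) : scalePot τ w r ≤ scalePot τ' w r :=
  mul_le_mul' (ENNReal.ofReal_le_ofReal h) le_rfl

/-- `τ ↦ E₀(τ•w)` is non-decreasing. [folklore] -/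
theorem periodicGroundStateEnergy_scalePot_mono (w : ℝ → ℝ≥0∞) {τ τ' : ℝ} (h : τ ≤ τ') (N : ℕ) (L : ℝ) :
    periodicGroundStateEnergy (scalePot τ w) N L ≤ periodicGroundStateEnergy (scalePot τ' w) N L :=
  iInf_mono fun Φ => periodicEnergy_mono (scalePot_mono w h) Φ

/-- Along the ray of a bounded potential every ground-state energy is finite (`L > 0`). [folklore] -/
theorem periodicGroundStateEnergy_scalePot_ne_top (hL : 0 < L)
    (hW : ∀ Φ : PeriodicTrialState (m + 1) L, interactionEnergy w Φ ≤ ENNReal.ofReal Wm) (τ : ℝ) :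
    periodicGroundStateEnergy (scalePot τ w) (m + 1) L ≠ ⊤ := by
  have hc : ((Real.sqrt (L ^ 3))⁻¹) ^ 2 * L ^ 3 = 1 := by
    rw [inv_pow, Real.sq_sqrt (by positivity), inv_mul_cancel₀ (by positivity)]
  exact ne_top_of_le_ne_top (periodicEnergy_scalePot_ne_top hW τ (constState m hL _ hc))
    (periodicGroundStateEnergy_le _ _)

/-- **Continuity of `τ ↦ E₀(τ•w)` on `[0, ∞)`** (in `ℝ`, for a bounded potential): the case `s' = 0` of the Lipschitz
continuity `ray_continuousOn` of the sourced infimum, the sourced functional being bounded below by the free chord. [folklore] -/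
theorem continuousOn_periodicGroundStateEnergy_scalePot (hL : 0 < L) {n : Fin 3 → ℤ} (hn : n ≠ 0) (hWm : 0 ≤ Wm)
    (hW : ∀ Φ : PeriodicTrialState (m + 1) L, interactionEnergy w Φ ≤ ENNReal.ofReal Wm) :
    ContinuousOn (fun τ : ℝ => (periodicGroundStateEnergy (scalePot τ w) (m + 1) L).toReal) (Ici 0) := by
  have hc : ((Real.sqrt (L ^ 3))⁻¹) ^ 2 * L ^ 3 = 1 := by
    rw [inv_pow, Real.sq_sqrt (by positivity), inv_mul_cancel₀ (by positivity)]
  haveI : Nonempty (PeriodicTrialState (m + 1) L) := ⟨constState m hL _ hc⟩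
  set F : ℝ → ℝ → PeriodicTrialState (m + 1) L → ℝ :=
    fun τ s' Φ => sourcedFunctional (scalePot τ w) m L n s' Φ with hFdef
  obtain ⟨e, he⟩ : ∃ e : ℝ → ℝ → ℝ, ∀ s' τ, e s' τ = ⨅ Φ, F τ s' Φ := ⟨_, fun _ _ => rfl⟩
  have hF : ∀ τ s' Φ, F τ s' Φ = (periodicEnergy 0 Φ).toReal + max τ 0 * (interactionEnergy w Φ).toReal
      - s' * (2 * (m + 1) * ‖sourceIntegral m L n Φ.ψ‖) := fun τ s' Φ => sourcedFunctional_scalePot hW τ s' Φ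
  have hfree : GDChordBody 0 (1 / (4 * Real.pi ^ 2)) m L n := fun s hs Φ => stub_freeCase m L hL n hn s hs Φ
  have hb : ∀ s' τ Φ, (periodicGroundStateEnergy 0 (m + 1) L).toReal -
      1 / (4 * Real.pi ^ 2) * s' ^ 2 * L ^ 2 / ‖(fun j => (n j : ℝ))‖ ^ 2 ≤ F τ s' Φ :=
    fun s' τ Φ => sourcedFunctional_ge_of_free hW (by positivity) hfree s' τ Φ
  have hcont := ray_continuousOn hW hWm hF he hb 0
  have hinf : ∀ τ, e 0 τ = (periodicGroundStateEnergy (scalePot τ w) (m + 1) L).toReal := fun τ => by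
    rw [he]
    unfold periodicGroundStateEnergy
    rw [ENNReal.toReal_iInf (periodicEnergy_scalePot_ne_top hW τ)]
    exact iInf_congr fun Φ => by simp [hFdef, sourcedFunctional]
  exact hcont.congr fun τ _ => (hinf τ).symm

end Ray

/-! ## The chord body of a bounded potential from the sign on the core -/

/-- **Core composition for a bounded admissible potential.**  Fix `(m, L > 0, n ≠ 0)`.  If at every ray point `τ•w`, `τ ∈ (0,1]`,
and every `s ≥ 0` in the CORE (`s·L² < 4π²√N‖n‖²` and `s²L² ≤ 4π²‖n‖² E₀(τ•w)`) the source does not lower the ground-state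
interaction energy, then the chord body of `w` holds with constant `1/(2π²)`: automatic chord above the first threshold, anchor band
above the second, and otherwise the anchor band at the ray point `τ₀•w` with `E₀(τ₀•w) = s²L²/(4π²‖n‖²)` (intermediate value
theorem) transported to `w` by `stub_chordTransportFrom` through core points only. [folklore] -/
theorem gdChordBody_of_coreSign {w : ℝ → ℝ≥0∞} (hw : IsRepulsiveFiniteRange w) (hB : ∃ B : ℝ, ∀ r, w r ≤ ENNReal.ofReal B)
    {m : ℕ} {L : ℝ} (hL : 0 < L) {n : Fin 3 → ℤ} (hn : n ≠ 0)
    (hsign : ∀ τ : ℝ, 0 < τ → τ ≤ 1 → ∀ s : ℝ, 0 ≤ s →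
      s * L ^ 2 < 4 * Real.pi ^ 2 * Real.sqrt ((m + 1 : ℕ) : ℝ) * ‖(fun j => (n j : ℝ))‖ ^ 2 →
      s ^ 2 * L ^ 2 ≤ 4 * Real.pi ^ 2 * ‖(fun j => (n j : ℝ))‖ ^ 2 *
          (periodicGroundStateEnergy (scalePot τ w) (m + 1) L).toReal →
      groundInteraction (scalePot τ w) m L n 0 ≤ groundInteraction (scalePot τ w) m L n s) :
    GDChordBody w (1 / (2 * Real.pi ^ 2)) m L n := by
  intro s hs Φ
  obtain ⟨Wm, hWm, hW⟩ := exists_interactionEnergy_le hw hB hL (m + 1)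
  set ν : ℝ := ‖(fun j => (n j : ℝ))‖ with hνdef
  have hν : 1 ≤ ν := one_le_norm_intVec hn
  have hνpos : 0 < ν := one_pos.trans_le hν
  set N : ℝ := ((m + 1 : ℕ) : ℝ) with hNdef
  have hNpos : 0 < N := by rw [hNdef]; exact_mod_cast Nat.succ_pos m
  set E : ℝ → ℝ := fun τ => (periodicGroundStateEnergy (scalePot τ w) (m + 1) L).toReal with hEdef
  have hEtop : ∀ τ, periodicGroundStateEnergy (scalePot τ w) (m + 1) L ≠ ⊤ :=
    periodicGroundStateEnergy_scalePot_ne_top hL hW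
  have hEmono : ∀ {τ τ' : ℝ}, τ ≤ τ' → E τ ≤ E τ' := fun h =>
    ENNReal.toReal_mono (hEtop _) (periodicGroundStateEnergy_scalePot_mono w h _ _)
  have hE0 : E 0 = 0 := by
    have h0 : scalePot 0 w = 0 := scalePot_zero w
    have hc : ((Real.sqrt (L ^ 3))⁻¹) ^ 2 * L ^ 3 = 1 := by
      rw [inv_pow, Real.sq_sqrt (by positivity), inv_mul_cancel₀ (by positivity)]
    have hle := periodicGroundStateEnergy_le (0 : ℝ → ℝ≥0∞) (constState m hL _ hc)
    rw [periodicEnergy_constState hL hc] at hle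
    have hE00 : periodicGroundStateEnergy 0 (m + 1) L = 0 := le_antisymm hle bot_le
    show (periodicGroundStateEnergy (scalePot 0 w) (m + 1) L).toReal = 0
    rw [h0, hE00, ENNReal.toReal_zero]
  have hw1 : scalePot 1 w = w := scalePot_one w
  -- Case A: above the automatic threshold
  by_cases hA : 4 * Real.pi ^ 2 * Real.sqrt N * ν ^ 2 ≤ s * L ^ 2
  · refine stub_chordAutomatic w m L hL n hn (1 / (2 * Real.pi ^ 2)) s hs ?_ Φ
    rw [← hNdef, ← hνdef]
    have : 1 / (2 * Real.pi ^ 2) * s * L ^ 2 = (1 / (2 * Real.pi ^ 2)) * (s * L ^ 2) := by ring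
    rw [this]
    calc 2 * Real.sqrt N * ν ^ 2 = (1 / (2 * Real.pi ^ 2)) * (4 * Real.pi ^ 2 * Real.sqrt N * ν ^ 2) := by
          field_simp
          norm_num
      _ ≤ (1 / (2 * Real.pi ^ 2)) * (s * L ^ 2) := mul_le_mul_of_nonneg_left hA (by positivity)
  push Not at hA
  -- the anchor band at a ray point where `4π²ν² E(τ) ≤ s²L²` ... used at `τ = 1` (Case B) and at `τ₀` (Case C)
  have hpen : (1 / (2 * Real.pi ^ 2) - 1 / (4 * Real.pi ^ 2)) * s ^ 2 * L ^ 2 / ν ^ 2 = s ^ 2 * L ^ 2 / (4 * Real.pi ^ 2 * ν ^ 2) := by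
    field_simp
    ring
  have hC14 : 1 / (4 * Real.pi ^ 2) ≤ 1 / (2 * Real.pi ^ 2) := by
    rw [div_le_div_iff₀ (by positivity) (by positivity)]
    nlinarith [Real.pi_pos, sq_nonneg Real.pi]
  have anchorAt : ∀ τ : ℝ, 4 * Real.pi ^ 2 * ν ^ 2 * E τ ≤ s ^ 2 * L ^ 2 →
      ∀ Ψ : PeriodicTrialState (m + 1) L, GDIneq (scalePot τ w) m L n (1 / (2 * Real.pi ^ 2)) s Ψ := by
    intro τ hτ Ψ
    refine stub_anchorBand (scalePot τ w) m L hL n hn (1 / (2 * Real.pi ^ 2)) s hC14 hs ?_ Ψ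
    rw [← hνdef, hpen, ← ENNReal.ofReal_toReal (hEtop τ)]
    refine ENNReal.ofReal_le_ofReal ?_
    rw [le_div_iff₀ (by positivity)]
    calc (periodicGroundStateEnergy (scalePot τ w) (m + 1) L).toReal * (4 * Real.pi ^ 2 * ν ^ 2)
        = 4 * Real.pi ^ 2 * ν ^ 2 * E τ := by simp only [hEdef]; ring
      _ ≤ s ^ 2 * L ^ 2 := hτ
  -- Case B: above the anchor band of `w` itself
  by_cases hBand : 4 * Real.pi ^ 2 * ν ^ 2 * E 1 ≤ s ^ 2 * L ^ 2
  · have h := anchorAt 1 hBand Φ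
    rwa [hw1] at h
  push Not at hBand
  -- Case C: the core.  `s = 0` is the variational principle.
  rcases hs.eq_or_lt with hs0 | hspos
  · subst hs0
    unfold GDIneq
    simp only [zero_mul, ENNReal.ofReal_zero, add_zero, mul_zero, zero_div,
      ne_eq, OfNat.ofNat_ne_zero, not_false_eq_true, zero_pow]
    exact periodicGroundStateEnergy_le w Φ
  -- intermediate value: `τ₀ ∈ [0,1]` with `4π²ν² E(τ₀) = s²L²`
  set y : ℝ := s ^ 2 * L ^ 2 / (4 * Real.pi ^ 2 * ν ^ 2) with hydef
  have hypos : 0 < y := by positivity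
  have hy1 : y < E 1 := by
    rw [hydef, div_lt_iff₀ (by positivity)]
    linarith
  have hEcont : ContinuousOn E (Icc 0 1) :=
    (continuousOn_periodicGroundStateEnergy_scalePot hL hn hWm hW).mono Icc_subset_Ici_self
  obtain ⟨τ₀, hτ₀I, hτ₀y⟩ : ∃ τ₀ ∈ Icc (0 : ℝ) 1, E τ₀ = y := by
    have hmem : y ∈ Icc (E 0) (E 1) := ⟨by rw [hE0]; exact hypos.le, hy1.le⟩
    exact intermediate_value_Icc zero_le_one hEcont hmem
  have hτ₀ : 0 ≤ τ₀ := hτ₀I.1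
  have hτ₀1 : τ₀ < 1 := by
    rcases hτ₀I.2.eq_or_lt with h1 | h1
    · exfalso; rw [h1] at hτ₀y; linarith
    · exact h1
  have hEq : 4 * Real.pi ^ 2 * ν ^ 2 * E τ₀ = s ^ 2 * L ^ 2 := by
    rw [hτ₀y, hydef]; field_simp
  -- transport from `τ₀` through core points
  refine stub_chordTransportFrom w hw hB m L hL n hn s hs τ₀ hτ₀ hτ₀1 ?_ (1 / (2 * Real.pi ^ 2)) (by positivity)
    (anchorAt τ₀ hEq.le) Φ
  intro τ hτ hτ1
  refine hsign τ (hτ₀.trans_lt hτ) hτ1 s hs hA ?_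
  calc s ^ 2 * L ^ 2 = 4 * Real.pi ^ 2 * ν ^ 2 * E τ₀ := hEq.symm
    _ ≤ 4 * Real.pi ^ 2 * ν ^ 2 * E τ := mul_le_mul_of_nonneg_left (hEmono hτ.le) (by positivity)

/-! ## The registered lead stub: the core sign suffices for the crux -/

/-- **Registered lead stub `stub_gdCan_of_sourceRaisesInteractionCore` of line `coupling-monotone-chord` (skeleton r8), proved**:
if for every window parameter `M > 0` and range `R₀` there is a density threshold `ρ₀(M, R₀) > 0` such that for every bounded measurable
`w ≥ 0` vanishing beyond `R₀`, every `(N = m+1, L)` with `N ≤ ρ₀L³`, every `n ≠ 0` in the window and every `s ≥ 0` IN THE CORE RANGE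
(`s·L² < 4π²√N‖n‖∞²`, `s²L² ≤ 4π²‖n‖∞² E₀(w)`) the LNSS source does not lower the ground-state interaction energy, then
`GaussianDominationCan` holds (with `C = 1/(2π²)`, `N₀ = 0`, `ρ₀ = ρ₀(M, R₀(v))`; hard cores by `truncationLimit_holds`). [folklore] -/
theorem stub_gdCan_of_sourceRaisesInteractionCore :
    (∀ M : ℝ, 0 < M → ∀ R₀ : ℝ, ∃ ρ₀ : ℝ, 0 < ρ₀ ∧
      ∀ w : ℝ → ℝ≥0∞, Measurable w → (∀ r, R₀ < r → w r = 0) → (∃ B : ℝ, ∀ r, w r ≤ ENNReal.ofReal B) →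
        ∀ m : ℕ, ∀ L : ℝ, 0 < L → ((m + 1 : ℕ) : ℝ) ≤ ρ₀ * L ^ 3 →
          ∀ n : Fin 3 → ℤ, n ≠ 0 → InWindow M m L n → ∀ s : ℝ, 0 ≤ s →
            s * L ^ 2 < 4 * Real.pi ^ 2 * Real.sqrt ((m + 1 : ℕ) : ℝ) * ‖(fun j => (n j : ℝ))‖ ^ 2 →
            s ^ 2 * L ^ 2 ≤ 4 * Real.pi ^ 2 * ‖(fun j => (n j : ℝ))‖ ^ 2 *
                (periodicGroundStateEnergy w (m + 1) L).toReal →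
            groundInteraction w m L n 0 ≤ groundInteraction w m L n s) →
    BECThomsonPrinciple.GaussianDominationCan := by
  intro hcore
  refine gaussianDominationCan_iff.mpr fun v hv M hM => ?_
  obtain ⟨hmeas, R₀, hR₀⟩ := hv
  obtain ⟨ρ₀, hρ₀, hsign⟩ := hcore M hM R₀
  refine ⟨ρ₀, 1 / (2 * Real.pi ^ 2), hρ₀, by positivity, 0, ?_⟩
  intro m _ L hL hdens n hn hwin
  change GDChordBody v (1 / (2 * Real.pi ^ 2)) m L n
  refine truncationLimit_holds v ⟨hmeas, R₀, hR₀⟩ m L hL n hn _ (by positivity) fun h _ => ?_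
  have hvh : IsRepulsiveFiniteRange (trunc v h) := isRepulsiveFiniteRange_trunc ⟨hmeas, R₀, hR₀⟩ h
  have hrange : ∀ r, R₀ < r → trunc v h r = 0 := fun r hr => by
    show min (v r) (ENNReal.ofReal h) = 0
    rw [hR₀ r hr]
    simp
  refine gdChordBody_of_coreSign hvh (trunc_bounded v h) hL hn fun τ hτ hτ1 s hs h1 h2 => ?_
  have hmeasτ : Measurable (scalePot τ (trunc v h)) := by
    unfold scalePot
    exact hvh.1.const_mul _
  have hrangeτ : ∀ r, R₀ < r → scalePot τ (trunc v h) r = 0 := fun r hr => by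
    show ENNReal.ofReal τ * trunc v h r = 0
    rw [hrange r hr, mul_zero]
  exact hsign (scalePot τ (trunc v h)) hmeasτ hrangeτ ⟨τ * h, scalePot_le hτ.le (trunc_le v h)⟩
    m L hL hdens n hn hwin s hs h1 h2

/-- **The crux from the core sign, in `GDCanWith` form with the data exposed** (`C = 1/(2π²)`, `N₀ = 0`). [folklore] -/
theorem gdCanWith_of_sourceRaisesInteractionCore
    (hcore : ∀ M : ℝ, 0 < M → ∀ R₀ : ℝ, ∃ ρ₀ : ℝ, 0 < ρ₀ ∧
      ∀ w : ℝ → ℝ≥0∞, Measurable w → (∀ r, R₀ < r → w r = 0) → (∃ B : ℝ, ∀ r, w r ≤ ENNReal.ofReal B) →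
        ∀ m : ℕ, ∀ L : ℝ, 0 < L → ((m + 1 : ℕ) : ℝ) ≤ ρ₀ * L ^ 3 →
          ∀ n : Fin 3 → ℤ, n ≠ 0 → InWindow M m L n → ∀ s : ℝ, 0 ≤ s →
            s * L ^ 2 < 4 * Real.pi ^ 2 * Real.sqrt ((m + 1 : ℕ) : ℝ) * ‖(fun j => (n j : ℝ))‖ ^ 2 →
            s ^ 2 * L ^ 2 ≤ 4 * Real.pi ^ 2 * ‖(fun j => (n j : ℝ))‖ ^ 2 *
                (periodicGroundStateEnergy w (m + 1) L).toReal →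
            groundInteraction w m L n 0 ≤ groundInteraction w m L n s) :
    ∀ v : ℝ → ℝ≥0∞, IsRepulsiveFiniteRange v → ∀ M : ℝ, 0 < M →
      ∃ ρ₀ C : ℝ, 0 < ρ₀ ∧ 0 < C ∧ ∃ N₀ : ℕ, GDCanWith ρ₀ C N₀ v M :=
  gaussianDominationCan_iff.mp (stub_gdCan_of_sourceRaisesInteractionCore hcore)

/-- The full sign B (`SourceRaisesInteraction`) implies the core sign (drop the two range hypotheses). [folklore] -/
theorem sourceRaisesInteractionCore_of_sourceRaisesInteraction (hB : SourceRaisesInteraction) :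
    ∀ M : ℝ, 0 < M → ∀ R₀ : ℝ, ∃ ρ₀ : ℝ, 0 < ρ₀ ∧
      ∀ w : ℝ → ℝ≥0∞, Measurable w → (∀ r, R₀ < r → w r = 0) → (∃ B : ℝ, ∀ r, w r ≤ ENNReal.ofReal B) →
        ∀ m : ℕ, ∀ L : ℝ, 0 < L → ((m + 1 : ℕ) : ℝ) ≤ ρ₀ * L ^ 3 →
          ∀ n : Fin 3 → ℤ, n ≠ 0 → InWindow M m L n → ∀ s : ℝ, 0 ≤ s →
            s * L ^ 2 < 4 * Real.pi ^ 2 * Real.sqrt ((m + 1 : ℕ) : ℝ) * ‖(fun j => (n j : ℝ))‖ ^ 2 →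
            s ^ 2 * L ^ 2 ≤ 4 * Real.pi ^ 2 * ‖(fun j => (n j : ℝ))‖ ^ 2 *
                (periodicGroundStateEnergy w (m + 1) L).toReal →
            groundInteraction w m L n 0 ≤ groundInteraction w m L n s := by
  intro M hM R₀
  obtain ⟨ρ₀, hρ₀, h⟩ := hB M hM R₀
  exact ⟨ρ₀, hρ₀, fun w hw hR hb m L hL hd n hn hwin s hs _ _ => h w hw hR hb m L hL hd n hn hwin s hs⟩

end Summit.AtomisticToContinuum.BoseEinsteinCondensation.Cruxes.GaussianDominationCan.CouplingMonotoneChord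

end
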